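/-
Copyright: the b2b-balaban T⁴-continuum CRUX team, row NE7b leaf lineage `t4-ne7b-formalise-leaf-04` (gen 151). Project licence.
-/
import Literature.Analysis.Convex.ProximalMap
import Mathlib.Analysis.Convex.Strong
import Mathlib.Data.Real.Pointwise

/-!
# THE SOFT STEP IS THE MOREAU ENVELOPE OF THE HARD STEP: `min_y [S y + a‖x − P y‖²] = min_z [φ z + a‖x − z‖²] = 2a·e_{φ∕(2a)}(x)`
# with `φ z = min {S y : P y = z}` the hard-constraint value; convexity and strong convexity DESCEND from `S` to `φ` (modulus
# `σ∕κ²` for `‖P y‖ ≤ κ‖y‖`), so for ANY convex `S` bounded below and ANY linear surjective `P` the quadratic-penalty value is a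
# Moreau envelope — `C¹` with gradient `2a(x − prox_{φ∕(2a)} x)`, `2a`-Lipschitz gradient, modulus `2aσ∕(σ + 2aκ²)` by
# `…MoreauEnvelopeLetters` BY NAME — and the averaged soft minimiser IS the proximal point: `P y₀ = prox_{φ∕(2a)} x`
# (row NE7b, node U5c; residual (R2′) family (2), letters (ℓ1)∕(ℓ2) through a CLASSICAL soft step; [folklore] convex analysis)

Cell `pub-balaban`, sub-cell `t4`, spine estimate NE7b (`T4WeightBudget.RelWeightBound`; the cell's OWN estimate — NOT PRINTED in
[Bałaban 1983–89], NOT PROVED).  Crux-route work under `Spine/NE7b/` by leaf-04 on the convexity road; NOTHING of Bałaban's is named or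
asserted; no `T4Continuum/Support` leaf typed; no `def`; zero `sorry`.  Imports: the tree's BUILT `Literature.Analysis.Convex.ProximalMap`
(`proxFun f x z = f z + ‖z − x‖²∕2`, `prox`, `isMinOn_prox`, `IsMinOn.eq_of_isMinOn_proxFun`) and Mathlib — independent of the `Spine/NE7b`
olean frontier (in particular it does NOT import this lineage's `…MoreauEnvelopeLetters` (MEL) ∕ `…MoreauProxJacobian` (MPJ), whose
theorems it is shaped to feed BY NAME).

WHY.  MEL types the soft (quadratic-penalty) step `e_f(x) = min_z [f z + ½‖z − x‖²]` with kept variable = fine variable.  The road's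
classical averaging step has a WEIGHT `a` and an OPERATOR `P` (block average; print's `exp(−a g⁻²Σ|V′ − Q̄V|²)`-type weight, T-80 (J4)):
`ψ(x) = min_y [S y + a‖x − P y‖²]`.  MEL's NOT-HERE names the junction typed here: minimising first along the fibres of `P` gives the
HARD-constraint value `φ z = min {S y : P y = z}` (leaf-03's `…ConstrainedValue*` ∕ `…ConstrainedSchur*` object, written out as
`⨅ y : {y ∕∕ P y = z}, S y` — nothing of theirs imported or restated), and `ψ(x) = min_z [φ z + a‖x − z‖²] = 2a · e_{φ∕(2a)}(x)`: THE SOFT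
STEP IS THE MOREAU ENVELOPE (parameter `1∕(2a)`) OF THE HARD STEP.  Convexity and strong convexity descend from `S` to `φ` through a linear
surjection (modulus `σ ↦ σ∕κ²` under `‖P y‖ ≤ κ‖y‖`), so `φ∕(2a)` is finite convex on the kept space and EVERY letter of MEL ∕ MPJ applies to
`ψ = 2a · e_{φ∕(2a)}`: `ψ ∈ C¹` with `∇ψ(x) = 2a(x − prox_{φ∕(2a)} x)` for ANY convex `S` bounded below (no differentiability of `S`, no
interior minimiser, no window margin — compare `…ConstrainedValueDeriv`'s `HasFDerivAt V V′ δ₀`), `∇ψ` `2a`-Lipschitz, modulus `2a·m∕(1+m)`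
with `m = σ∕(2aκ²)`, i.e. `2aσ∕(σ + 2aκ²)` = the OWNER's (30) `…FluctuationStepModulus` number for the `2a`-convex weight `a‖·‖²` and this
lineage's `…AveragingFloorTower` §2 in first-order currency; and the soft minimiser's average is the proximal point, `P y₀ = prox_{φ∕(2a)} x` —
the soft step's background field, read in the kept variable, is MPJ's `C¹` contraction.

WHAT IS PROVED ([folklore]; Rockafellar–Wets, *Variational Analysis* (1998) 1.F ∕ Ex. 11.57 (quadratic penalty = Moreau envelope of the
perturbation function), 2.22 (convexity of the infimal projection); Bertsekas, *Constrained Optimization and Lagrange Multiplier Methods*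
(1982) Ch. 3; proved here from order arithmetic on `ℝ` and the tree's `prox` API, nothing cited as a fact).  `⨅` is Mathlib's conditionally
complete infimum on `ℝ`; every statement carries the bounded-below ∕ surjectivity letters that make it the minimum it denotes.
* §1 FIBREWISE INFIMA: `bddBelow_fibre`, `ciInf_add_const`, `iInf_fibre_add_const` (`⨅_{P y = z} (S y + c) = φ z + c`), **`iInf_eq_iInf_fibre`**
  (`⨅_y g y = ⨅_z ⨅_{P y = z} g y` for `g` bounded below, `P` onto — any types), **`softValue_eq_iInf_hardValue`**
  (`⨅_y [S y + c (P y)] = ⨅_z [φ z + c z]` for `S`, `c` bounded below).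
* §2 THE SOFT STEP IS THE MOREAU ENVELOPE OF THE HARD STEP: **`softValue_eq_iInf_hardValue_sq`** (`c z = a‖x − z‖²`, `0 ≤ a`),
  `proxFun_div_eq` (`2a · proxFun (φ∕(2a)) x z = φ z + a‖x − z‖²`), **`softValue_eq_mul_iInf_proxFun`** (`ψ x = 2a · ⨅_z proxFun (φ∕(2a)) x z`,
  `0 < a`), `iInf_proxFun_eq_proxEnv` (for finite convex `f` the infimum is ATTAINED at `prox f x`: `⨅_z proxFun f x z = proxFun f x (prox f x)`),
  **`softValue_eq_mul_proxEnv`** (`ψ x = 2a · e_{φ∕(2a)}(x)` written out, `φ∕(2a)` convex), **`apply_eq_prox_of_isMinOn_soft`** (a soft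
  minimiser `y₀` has `P y₀ = prox (φ∕(2a)) x` — the averaged background field IS the proximal point).
* §3 CONVEXITY DESCENDS TO THE HARD VALUE (`P : E →ₗ[ℝ] F` onto, `S` bounded below): `hardValue_secant_of_secant` (the engine: a secant letter of `S` between the fibres of `z₁, z₂` with ANY defect `C` descends to `φ`),
  **`convexOn_hardValue`** (`ConvexOn ℝ univ S ⟹ ConvexOn ℝ univ φ`), **`strongConvexOn_hardValue`** (`StrongConvexOn univ σ S`, `0 ≤ σ`,
  `‖P y‖ ≤ κ‖y‖`, `0 < κ` ⟹ `StrongConvexOn univ (σ∕κ²) φ` — SHARP: `S = ½σ‖·‖²`, `P = κ·id`), `strongConvexOn_div_const` ∕ `convexOn_div_const`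
  (`φ∕(2a)` keeps (strong) convexity with modulus `m∕(2a)`).
* §4 THE END FROM `S`'s DATA ALONE: **`softValue_eq_mul_proxEnv_of_convexOn`** (`S` convex bounded below, `P` linear onto, `0 < a` ⟹
  `⨅_y [S y + a‖x − P y‖²] = 2a · proxFun (φ∕(2a)) x (prox (φ∕(2a)) x)` at EVERY `x`), **`apply_eq_prox_of_isMinOn_soft_of_convexOn`**,
  `strongConvexOn_hardValue_div` (`φ∕(2a)` is `(σ∕(2aκ²))`-strongly convex), `modulus_bookkeeping` (`2a · (m∕(1+m)) = 2aσ∕(σ + 2aκ²)` for `m = σ∕(2aκ²)` — the number MEL's `strongConvexOn_proxEnv` returns for `ψ`).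
* §5 toys (kernel): `P = id` returns `φ = S` (`hardValue_id`); the END instantiated on `S = 0`, `P = id` (`example`).

NOT HERE (honest): the letters themselves for `ψ` (`HasGradientAt`, Lipschitz gradient, `StrongConvexOn univ (2aσ∕(σ+2aκ²)) ψ`) = MEL §3–§5 ∕
MPJ on `f := φ∕(2a)` times `2a`, one `exact` + `smul` each once MEL's hub olean exists (junction certificate owed; this file is import-free of
MEL on purpose, to land through the fast lane); EXISTENCE of a soft minimiser `y₀` (displayed as a hypothesis; leaf-03's `exists_isMinOn_fibre`
pattern); windows (`S = +∞` off `K` needs `φ_K` and a constrained prox — `…ConstrainedValueWindow` currency); which `S, P, a` of Bałaban's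
((A3) ∕ (A1c), NC-NE7b-α UNRULED); anything of Bałaban's.
BY-NAME EFFECT ON THE WALL: NONE.  NE7b NOT PRINTED ∕ NOT PROVED; spine PROVED 0∕9; rung (B)+1 on a FINITE torus — NOT infinite volume, NOT
the mass gap, NOT Clay.  HONEST DEPENDENCY: continuum YM on T⁴ ⇐ BetaPertH ∧ nine spine estimates (0/9 proved); BetaPertH ⇐ (D1) ∧ (D4) ∧
CAP+tail; G-an2-4 gates asym, D1 and NE2∕3∕4.
-/

set_option autoImplicit false

noncomputable section

namespace Summit.QuantumFields.BalabanUV.T4Continuum.NE7b.SoftConstraintEnvelope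

open Set Function
open Literature.Analysis.Convex

/-! ## §1 Fibrewise infima: minimising first along the fibres of `P` -/

section Fibre

variable {E F : Type*}

/-- A function bounded below is bounded below on every fibre. [folklore] -/
theorem bddBelow_fibre {S : E → ℝ} (hS : BddBelow (range S)) (P : E → F) (z : F) :
    BddBelow (range fun y : {y // P y = z} => S y.1) := by
  obtain ⟨b, hb⟩ := hS
  exact ⟨b, by rintro _ ⟨y, rfl⟩; exact hb ⟨y.1, rfl⟩⟩

/-- On a non-empty index type, adding a constant commutes with the infimum of a function bounded below. [folklore] -/
theorem ciInf_add_const {ι : Type*} [Nonempty ι] {g : ι → ℝ} (hg : BddBelow (range g)) (c : ℝ) :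
    ⨅ i, (g i + c) = (⨅ i, g i) + c := by
  have hg' : BddBelow (range fun i => g i + c) := by
    obtain ⟨b, hb⟩ := hg
    exact ⟨b + c, by rintro _ ⟨i, rfl⟩; dsimp only; linarith [hb ⟨i, rfl⟩]⟩
  refine le_antisymm ?_ (le_ciInf fun i => by linarith [ciInf_le hg i])
  have h : (⨅ i, (g i + c)) - c ≤ ⨅ i, g i := le_ciInf fun i => by linarith [ciInf_le hg' i]
  linarith

/-- **THE HARD VALUE PLUS A CONSTANT**: on a non-empty fibre, `⨅_{P y = z} (S y + c) = (⨅_{P y = z} S y) + c`. [folklore] -/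
theorem iInf_fibre_add_const {S : E → ℝ} (hS : BddBelow (range S)) (P : E → F) {z : F} (hz : ∃ y, P y = z) (c : ℝ) :
    ⨅ y : {y // P y = z}, (S y.1 + c) = (⨅ y : {y // P y = z}, S y.1) + c := by
  obtain ⟨y₀, hy₀⟩ := hz
  haveI : Nonempty {y // P y = z} := ⟨⟨y₀, hy₀⟩⟩
  exact ciInf_add_const (bddBelow_fibre hS P z) c

/-- **MINIMISE ALONG THE FIBRES FIRST**: for `g` bounded below and `P` onto, `⨅_y g y = ⨅_z ⨅_{P y = z} g y` (both sides the same
real number; on an empty `E` both are `0` by Mathlib's convention). [folklore] -/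
theorem iInf_eq_iInf_fibre (g : E → ℝ) (P : E → F) (hP : Surjective P) (hg : BddBelow (range g)) :
    ⨅ y, g y = ⨅ z, ⨅ y : {y // P y = z}, g y.1 := by
  rcases isEmpty_or_nonempty E with hE | hE
  · haveI : IsEmpty F := ⟨fun z => hE.elim (hP z).choose⟩
    rw [Real.iInf_of_isEmpty, Real.iInf_of_isEmpty]
  obtain ⟨b, hb⟩ := hg
  haveI : Nonempty F := ⟨P hE.some⟩
  have hne : ∀ z, Nonempty {y // P y = z} := fun z => let ⟨y, hy⟩ := hP z; ⟨⟨y, hy⟩⟩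
  have hfib : ∀ z, BddBelow (range fun y : {y // P y = z} => g y.1) := fun z => bddBelow_fibre ⟨b, hb⟩ P z
  have hzb : BddBelow (range fun z => ⨅ y : {y // P y = z}, g y.1) :=
    ⟨b, by rintro _ ⟨z, rfl⟩; haveI := hne z; exact le_ciInf fun y => hb ⟨y.1, rfl⟩⟩
  refine le_antisymm (le_ciInf fun z => ?_) (le_ciInf fun y => ?_)
  · haveI := hne z
    exact le_ciInf fun y => ciInf_le ⟨b, hb⟩ y.1
  · exact (ciInf_le hzb (P y)).trans (ciInf_le (hfib (P y)) ⟨y, rfl⟩)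

/-- **THE SOFT VALUE THROUGH THE HARD VALUE**: `S` bounded below, `c` bounded below on the base, `P` onto ⟹
`⨅_y [S y + c (P y)] = ⨅_z [(⨅_{P y = z} S y) + c z]` — any penalty `c` that only sees the base point. [folklore] -/
theorem softValue_eq_iInf_hardValue (S : E → ℝ) (P : E → F) (hP : Surjective P) (hS : BddBelow (range S))
    (c : F → ℝ) (hc : BddBelow (range c)) :
    ⨅ y, (S y + c (P y)) = ⨅ z, ((⨅ y : {y // P y = z}, S y.1) + c z) := by
  have hg : BddBelow (range fun y => S y + c (P y)) := by
    obtain ⟨b, hb⟩ := hS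
    obtain ⟨b', hb'⟩ := hc
    exact ⟨b + b', by rintro _ ⟨y, rfl⟩; exact add_le_add (hb ⟨y, rfl⟩) (hb' ⟨P y, rfl⟩)⟩
  rw [iInf_eq_iInf_fibre (fun y => S y + c (P y)) P hP hg]
  refine iInf_congr fun z => ?_
  have h1 : (⨅ y : {y // P y = z}, (S y.1 + c (P y.1))) = ⨅ y : {y // P y = z}, (S y.1 + c z) :=
    iInf_congr fun y => by rw [y.2]
  rw [h1, iInf_fibre_add_const hS P (hP z) (c z)]

end Fibre

/-! ## §2 The quadratic penalty: the soft step is the Moreau envelope of the hard step -/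

section Prox

variable {E F : Type*} [NormedAddCommGroup F] [InnerProductSpace ℝ F]

omit [InnerProductSpace ℝ F] in
/-- **`ψ(x) = min_z [φ z + a‖x − z‖²]`**: the quadratic-penalty value through the hard-constraint value (`0 ≤ a`). [folklore] -/
theorem softValue_eq_iInf_hardValue_sq (S : E → ℝ) (P : E → F) (hP : Surjective P) (hS : BddBelow (range S)) {a : ℝ}
    (ha : 0 ≤ a) (x : F) :
    ⨅ y, (S y + a * ‖x - P y‖ ^ 2) = ⨅ z, ((⨅ y : {y // P y = z}, S y.1) + a * ‖x - z‖ ^ 2) :=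
  softValue_eq_iInf_hardValue S P hP hS (fun z => a * ‖x - z‖ ^ 2) ⟨0, by rintro _ ⟨z, rfl⟩; positivity⟩

omit [InnerProductSpace ℝ F] in
/-- The rescaling between the weighted penalty and the tree's kernel `½‖z − x‖²`:
`2a · proxFun (φ∕(2a)) x z = φ z + a‖x − z‖²` (`a ≠ 0`). [folklore] -/
theorem proxFun_div_eq (φ : F → ℝ) {a : ℝ} (ha : a ≠ 0) (x z : F) :
    2 * a * proxFun (fun w => φ w / (2 * a)) x z = φ z + a * ‖x - z‖ ^ 2 := by
  rw [proxFun_apply, norm_sub_rev z x]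
  field_simp

omit [InnerProductSpace ℝ F] in
/-- **`ψ(x) = 2a · min_z proxFun (φ∕(2a)) x z`** (`0 < a`): the soft value is `2a` times the infimum of the tree's proximal functional of
the rescaled hard value. [folklore] -/
theorem softValue_eq_mul_iInf_proxFun (S : E → ℝ) (P : E → F) (hP : Surjective P) (hS : BddBelow (range S)) {a : ℝ}
    (ha : 0 < a) (x : F) :
    ⨅ y, (S y + a * ‖x - P y‖ ^ 2)
      = 2 * a * ⨅ z, proxFun (fun w => (⨅ y : {y // P y = w}, S y.1) / (2 * a)) x z := by
  rw [softValue_eq_iInf_hardValue_sq S P hP hS ha.le x, Real.mul_iInf_of_nonneg (by positivity)]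
  exact iInf_congr fun z => (proxFun_div_eq (fun w => ⨅ y : {y // P y = w}, S y.1) ha.ne' x z).symm

variable [FiniteDimensional ℝ F]

/-- **THE INFIMUM OF THE PROXIMAL FUNCTIONAL IS ATTAINED AT `prox`** (finite dimension, `f` finite convex):
`⨅_z proxFun f x z = proxFun f x (prox f x)` — the Moreau envelope value, as MEL writes it. [folklore] -/
theorem iInf_proxFun_eq_proxEnv {f : F → ℝ} (hf : ConvexOn ℝ univ f) (x : F) :
    ⨅ z, proxFun f x z = proxFun f x (prox f x) := by
  have hmin : ∀ z, proxFun f x (prox f x) ≤ proxFun f x z := fun z => isMinOn_prox hf x (mem_univ z)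
  exact le_antisymm (ciInf_le ⟨proxFun f x (prox f x), by rintro _ ⟨z, rfl⟩; exact hmin z⟩ (prox f x)) (le_ciInf hmin)

/-- **THE SOFT STEP IS THE MOREAU ENVELOPE OF THE HARD STEP** (`φ∕(2a)` finite convex on the kept space, `0 < a`):
`⨅_y [S y + a‖x − P y‖²] = 2a · proxFun (φ∕(2a)) x (prox (φ∕(2a)) x) = 2a · e_{φ∕(2a)}(x)` — so MEL's theorems for `f := φ∕(2a)` are
theorems about `ψ∕(2a)`. [folklore] -/
theorem softValue_eq_mul_proxEnv (S : E → ℝ) (P : E → F) (hP : Surjective P) (hS : BddBelow (range S)) {a : ℝ} (ha : 0 < a)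
    (hφ : ConvexOn ℝ univ fun w => (⨅ y : {y // P y = w}, S y.1) / (2 * a)) (x : F) :
    ⨅ y, (S y + a * ‖x - P y‖ ^ 2)
      = 2 * a * proxFun (fun w => (⨅ y : {y // P y = w}, S y.1) / (2 * a)) x
          (prox (fun w => (⨅ y : {y // P y = w}, S y.1) / (2 * a)) x) := by
  rw [softValue_eq_mul_iInf_proxFun S P hP hS ha x, iInf_proxFun_eq_proxEnv hφ x]

/-- **THE AVERAGED SOFT MINIMISER IS THE PROXIMAL POINT**: if `y₀` minimises `y ↦ S y + a‖x − P y‖²` then `P y₀ = prox (φ∕(2a)) x`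
(`P y₀` minimises `z ↦ φ z + a‖x − z‖²`, whose minimiser is unique — the tree's `IsMinOn.eq_of_isMinOn_proxFun`). [folklore] -/
theorem apply_eq_prox_of_isMinOn_soft (S : E → ℝ) (P : E → F) (hP : Surjective P) (hS : BddBelow (range S)) {a : ℝ} (ha : 0 < a)
    (hφ : ConvexOn ℝ univ fun w => (⨅ y : {y // P y = w}, S y.1) / (2 * a)) {x : F} {y₀ : E}
    (hy₀ : ∀ y, S y₀ + a * ‖x - P y₀‖ ^ 2 ≤ S y + a * ‖x - P y‖ ^ 2) :
    P y₀ = prox (fun w => (⨅ y : {y // P y = w}, S y.1) / (2 * a)) x := by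
  set f : F → ℝ := fun w => (⨅ y : {y // P y = w}, S y.1) / (2 * a) with hf
  have hle0 : (⨅ y : {y // P y = P y₀}, S y.1) ≤ S y₀ := ciInf_le (bddBelow_fibre hS P (P y₀)) ⟨y₀, rfl⟩
  have hmin : IsMinOn (proxFun f x) univ (P y₀) := by
    intro z _
    rw [mem_setOf_eq]
    obtain ⟨y₁, hy₁⟩ := hP z
    haveI : Nonempty {y // P y = z} := ⟨⟨y₁, hy₁⟩⟩
    -- `2a · proxFun f x (P y₀) ≤ S y₀ + a‖x − P y₀‖² ≤ S y + a‖x − z‖²` on the fibre of `z`, hence `≤ φ z + a‖x − z‖²`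
    have h1 : 2 * a * proxFun f x (P y₀) ≤ S y₀ + a * ‖x - P y₀‖ ^ 2 := by rw [hf, proxFun_div_eq _ ha.ne']; linarith
    have h2 : S y₀ + a * ‖x - P y₀‖ ^ 2 - a * ‖x - z‖ ^ 2 ≤ ⨅ y : {y // P y = z}, S y.1 :=
      le_ciInf fun y => by have := hy₀ y.1; rw [y.2] at this; linarith
    have h3 : 2 * a * proxFun f x z = (⨅ y : {y // P y = z}, S y.1) + a * ‖x - z‖ ^ 2 := by rw [hf, proxFun_div_eq _ ha.ne']
    have h4 : 2 * a * proxFun f x (P y₀) ≤ 2 * a * proxFun f x z := by linarith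
    exact le_of_mul_le_mul_left h4 (by positivity)
  exact (IsMinOn.eq_of_isMinOn_proxFun hφ (isMinOn_prox hφ x) hmin).symm

end Prox

/-! ## §3 Convexity and strong convexity descend to the hard-constraint value through a linear surjection -/

section Descend

variable {E F : Type*} [AddCommGroup E] [Module ℝ E] [AddCommGroup F] [Module ℝ F]

/-- **THE ENGINE**: a two-point secant letter of `S` between the fibres of `z₁` and `z₂` with weights `t, s ≥ 0`, `t + s = 1` and ANY
defect `C` — `S (t y₁ + s y₂) ≤ t S y₁ + s S y₂ − C` whenever `P y₁ = z₁`, `P y₂ = z₂` — DESCENDS to the hard value: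
`φ (t z₁ + s z₂) ≤ t φ z₁ + s φ z₂ − C` (`P` linear onto, `S` bounded below; minimise in `y₁`, then in `y₂`). [folklore] -/
theorem hardValue_secant_of_secant {S : E → ℝ} (hS : BddBelow (range S)) (P : E →ₗ[ℝ] F) (hP : Surjective P)
    {z₁ z₂ : F} {t s : ℝ} (ht : 0 ≤ t) (hs : 0 ≤ s) {C : ℝ}
    (hsec : ∀ y₁ y₂ : E, P y₁ = z₁ → P y₂ = z₂ → S (t • y₁ + s • y₂) ≤ t * S y₁ + s * S y₂ - C) :
    (⨅ y : {y // P y = t • z₁ + s • z₂}, S y.1)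
      ≤ t * (⨅ y : {y // P y = z₁}, S y.1) + s * (⨅ y : {y // P y = z₂}, S y.1) - C := by
  obtain ⟨u₁, hu₁⟩ := hP z₁
  obtain ⟨u₂, hu₂⟩ := hP z₂
  haveI : Nonempty {y // P y = z₁} := ⟨⟨u₁, hu₁⟩⟩
  haveI : Nonempty {y // P y = z₂} := ⟨⟨u₂, hu₂⟩⟩
  set L : ℝ := ⨅ y : {y // P y = t • z₁ + s • z₂}, S y.1 with hL
  -- the value at the combination is below every two-fibre competitor
  have hcomb : ∀ (y₁ : {y // P y = z₁}) (y₂ : {y // P y = z₂}), L ≤ t * S y₁.1 + s * S y₂.1 - C := by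
    intro y₁ y₂
    have hmem : P (t • y₁.1 + s • y₂.1) = t • z₁ + s • z₂ := by rw [map_add, map_smul, map_smul, y₁.2, y₂.2]
    exact (ciInf_le (bddBelow_fibre hS P _) ⟨t • y₁.1 + s • y₂.1, hmem⟩).trans (hsec y₁.1 y₂.1 y₁.2 y₂.2)
  -- minimise in `y₁`: `t φ z₁ = ⨅ t S y₁`
  have h1 : ∀ y₂ : {y // P y = z₂}, L - s * S y₂.1 + C ≤ t * ⨅ y : {y // P y = z₁}, S y.1 := by
    intro y₂
    rw [Real.mul_iInf_of_nonneg ht]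
    exact le_ciInf fun y₁ => by linarith [hcomb y₁ y₂]
  -- then in `y₂`
  have h2 : L - t * (⨅ y : {y // P y = z₁}, S y.1) + C ≤ s * ⨅ y : {y // P y = z₂}, S y.1 := by
    rw [Real.mul_iInf_of_nonneg hs]
    exact le_ciInf fun y₂ => by linarith [h1 y₂]
  linarith

/-- **CONVEXITY DESCENDS**: `S` convex (on `univ`) and bounded below, `P` linear onto ⟹ the hard-constraint value
`z ↦ ⨅_{P y = z} S y` is convex on `univ` (Rockafellar–Wets 2.22; the `a = ∞` companion of `…ConstrainedSchurForm` §6's secant letter, in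
Mathlib's `ConvexOn` currency so that the tree's `prox` applies). [folklore] -/
theorem convexOn_hardValue {S : E → ℝ} (hSc : ConvexOn ℝ univ S) (hS : BddBelow (range S)) (P : E →ₗ[ℝ] F)
    (hP : Surjective P) : ConvexOn ℝ univ fun z => ⨅ y : {y // P y = z}, S y.1 := by
  refine ⟨convex_univ, fun z₁ _ z₂ _ t s ht hs hts => ?_⟩
  have h := hardValue_secant_of_secant hS P hP (z₁ := z₁) (z₂ := z₂) ht hs (C := 0)
    (fun y₁ y₂ (_ : P y₁ = z₁) (_ : P y₂ = z₂) => by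
      have := hSc.2 (mem_univ y₁) (mem_univ y₂) ht hs hts; simp only [smul_eq_mul] at this; linarith)
  simp only [smul_eq_mul]
  linarith

end Descend

section DescendNormed

variable {E F : Type*} [NormedAddCommGroup E] [NormedSpace ℝ E] [NormedAddCommGroup F] [NormedSpace ℝ F]

/-- **STRONG CONVEXITY DESCENDS WITH MODULUS `σ∕κ²`**: `S` `σ`-strongly convex on `univ` (`0 ≤ σ`) and bounded below, `P` linear onto with
`‖P y‖ ≤ κ‖y‖` (`0 < κ`) ⟹ the hard-constraint value is `(σ∕κ²)`-strongly convex on `univ` (two fibre points over `z₁, z₂` are at distance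
`≥ ‖z₁ − z₂‖∕κ`).  SHARP: `S = ½σ‖·‖²`, `P = κ·id` gives `φ = (σ∕(2κ²))‖·‖²`. [folklore] -/
theorem strongConvexOn_hardValue {S : E → ℝ} {σ : ℝ} (hSc : StrongConvexOn univ σ S) (hσ : 0 ≤ σ) (hS : BddBelow (range S))
    (P : E →ₗ[ℝ] F) (hP : Surjective P) {κ : ℝ} (hκ : 0 < κ) (hPκ : ∀ y, ‖P y‖ ≤ κ * ‖y‖) :
    StrongConvexOn univ (σ / κ ^ 2) fun z => ⨅ y : {y // P y = z}, S y.1 := by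
  refine ⟨convex_univ, fun z₁ _ z₂ _ t s ht hs hts => ?_⟩
  have h := hardValue_secant_of_secant hS P hP (z₁ := z₁) (z₂ := z₂) ht hs
    (C := t * s * (σ / κ ^ 2 / 2 * ‖z₁ - z₂‖ ^ 2))
    (fun y₁ y₂ (hy₁ : P y₁ = z₁) (hy₂ : P y₂ = z₂) => by
      have hS2 := hSc.2 (mem_univ y₁) (mem_univ y₂) ht hs hts
      simp only [smul_eq_mul] at hS2
      -- `‖z₁ − z₂‖ ≤ κ‖y₁ − y₂‖`
      have hdist : ‖z₁ - z₂‖ ≤ κ * ‖y₁ - y₂‖ := by rw [← hy₁, ← hy₂, ← map_sub]; exact hPκ _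
      have hsq : ‖z₁ - z₂‖ ^ 2 ≤ κ ^ 2 * ‖y₁ - y₂‖ ^ 2 := by
        rw [← mul_pow]; exact pow_le_pow_left₀ (norm_nonneg _) hdist 2
      have hC : t * s * (σ / κ ^ 2 / 2 * ‖z₁ - z₂‖ ^ 2) ≤ t * s * (σ / 2 * ‖y₁ - y₂‖ ^ 2) := by
        refine mul_le_mul_of_nonneg_left ?_ (mul_nonneg ht hs)
        have e : σ / κ ^ 2 / 2 * ‖z₁ - z₂‖ ^ 2 = σ / 2 * (‖z₁ - z₂‖ ^ 2 / κ ^ 2) := by field_simp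
        rw [e]
        exact mul_le_mul_of_nonneg_left ((div_le_iff₀ (by positivity)).2 (by linarith)) (by positivity)
      linarith)
  simp only [smul_eq_mul]
  linarith

/-- Dividing by a positive constant divides the modulus: `StrongConvexOn univ m f ⟹ StrongConvexOn univ (m∕c) (f∕c)` (`0 < c`). [folklore] -/
theorem strongConvexOn_div_const {f : F → ℝ} {m c : ℝ} (hf : StrongConvexOn univ m f) (hc : 0 < c) :
    StrongConvexOn univ (m / c) fun z => f z / c := by
  refine ⟨convex_univ, fun x _ y _ a b ha hb hab => ?_⟩
  have h := hf.2 (mem_univ x) (mem_univ y) ha hb hab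
  simp only [smul_eq_mul] at h ⊢
  have e1 : a * (f x / c) + b * (f y / c) - a * b * (m / c / 2 * ‖x - y‖ ^ 2)
      = (a * f x + b * f y - a * b * (m / 2 * ‖x - y‖ ^ 2)) / c := by
    field_simp
  rw [e1]
  exact div_le_div_of_nonneg_right h hc.le

/-- Dividing by a positive constant keeps convexity. [folklore] -/
theorem convexOn_div_const {f : F → ℝ} {c : ℝ} (hf : ConvexOn ℝ univ f) (hc : 0 < c) : ConvexOn ℝ univ fun z => f z / c := by
  have h := strongConvexOn_div_const (strongConvexOn_zero.2 hf) hc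
  rw [zero_div] at h
  exact strongConvexOn_zero.1 h

end DescendNormed

/-! ## §4 THE END from `S`'s data alone: convex `S` bounded below, `P` linear onto, weight `a > 0` -/

section End

variable {E F : Type*} [NormedAddCommGroup E] [NormedSpace ℝ E] [NormedAddCommGroup F] [InnerProductSpace ℝ F]
  [FiniteDimensional ℝ F]

/-- **THE SOFT AVERAGING STEP OF A CONVEX ACTION IS A MOREAU ENVELOPE**: `S` convex on `univ` and bounded below, `P : E →ₗ[ℝ] F` onto,
`0 < a` ⟹ at EVERY `x`, `⨅_y [S y + a‖x − P y‖²] = 2a · proxFun (φ∕(2a)) x (prox (φ∕(2a)) x)` with `φ z = ⨅_{P y = z} S y` convex — hence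
(MEL BY NAME on `f := φ∕(2a)`) `ψ` is `C¹` with `∇ψ(x) = 2a(x − prox (φ∕(2a)) x)`, `∇ψ` is `2a`-Lipschitz, and `ψ` obeys the sockets' pair
with growth `a` and modulus `2a·m∕(1+m)`, `m` the modulus of `φ∕(2a)` (§3). [folklore] -/
theorem softValue_eq_mul_proxEnv_of_convexOn {S : E → ℝ} (hSc : ConvexOn ℝ univ S) (hS : BddBelow (range S))
    (P : E →ₗ[ℝ] F) (hP : Surjective P) {a : ℝ} (ha : 0 < a) (x : F) :
    ⨅ y, (S y + a * ‖x - P y‖ ^ 2)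
      = 2 * a * proxFun (fun w => (⨅ y : {y // P y = w}, S y.1) / (2 * a)) x
          (prox (fun w => (⨅ y : {y // P y = w}, S y.1) / (2 * a)) x) :=
  softValue_eq_mul_proxEnv S P hP hS ha (convexOn_div_const (convexOn_hardValue hSc hS P hP) (by positivity)) x

/-- **THE AVERAGED BACKGROUND FIELD OF THE SOFT STEP IS THE PROXIMAL POINT**, from `S`'s data alone: any minimiser `y₀` of
`y ↦ S y + a‖x − P y‖²` has `P y₀ = prox (φ∕(2a)) x` — so, read in the kept variable, the background field is MPJ's `C¹`
`(1 + m)⁻¹`-contraction. [folklore] -/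
theorem apply_eq_prox_of_isMinOn_soft_of_convexOn {S : E → ℝ} (hSc : ConvexOn ℝ univ S) (hS : BddBelow (range S))
    (P : E →ₗ[ℝ] F) (hP : Surjective P) {a : ℝ} (ha : 0 < a) {x : F} {y₀ : E}
    (hy₀ : ∀ y, S y₀ + a * ‖x - P y₀‖ ^ 2 ≤ S y + a * ‖x - P y‖ ^ 2) :
    P y₀ = prox (fun w => (⨅ y : {y // P y = w}, S y.1) / (2 * a)) x :=
  apply_eq_prox_of_isMinOn_soft S P hP hS ha (convexOn_div_const (convexOn_hardValue hSc hS P hP) (by positivity)) hy₀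

omit [FiniteDimensional ℝ F] in
/-- **THE MODULUS OF `φ∕(2a)` FROM `S`'s**: `S` `σ`-strongly convex (`0 ≤ σ`), `‖P y‖ ≤ κ‖y‖` (`0 < κ`), `0 < a` ⟹ `φ∕(2a)` is
`(σ∕(2aκ²))`-strongly convex on the kept space — the `m` to feed MEL's `strongConvexOn_proxEnv` ∕ `proxEnv_firstOrder_of_strongConvexOn`.
[folklore] -/
theorem strongConvexOn_hardValue_div {S : E → ℝ} {σ : ℝ} (hSc : StrongConvexOn univ σ S) (hσ : 0 ≤ σ) (hS : BddBelow (range S))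
    (P : E →ₗ[ℝ] F) (hP : Surjective P) {κ : ℝ} (hκ : 0 < κ) (hPκ : ∀ y, ‖P y‖ ≤ κ * ‖y‖) {a : ℝ} (ha : 0 < a) :
    StrongConvexOn univ (σ / (2 * a * κ ^ 2)) fun w => (⨅ y : {y // P y = w}, S y.1) / (2 * a) := by
  have h := strongConvexOn_div_const (strongConvexOn_hardValue hSc hσ hS P hP hκ hPκ) (show (0 : ℝ) < 2 * a by positivity)
  have e : σ / κ ^ 2 / (2 * a) = σ / (2 * a * κ ^ 2) := by
    field_simp
  rw [e] at h
  exact h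

/-- **MODULUS BOOKKEEPING**: with `m = σ∕(2aκ²)`, MEL's envelope modulus `m∕(1+m)` scaled back by `2a` is `2aσ∕(σ + 2aκ²)` — the OWNER's
(30) number `a′σ∕(σ + a′κ²)` for the `a′ = 2a`-convex weight `a‖·‖²`, and `…AveragingFloorTower` §2's `aγ∕(γ + aq²)` shape
(resistances add: `(2aσ∕(σ+2aκ²))⁻¹ = (σ∕κ²)⁻¹ + (2a)⁻¹`). [folklore] -/
theorem modulus_bookkeeping {σ κ a : ℝ} (hσ : 0 ≤ σ) (hκ : 0 < κ) (ha : 0 < a) :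
    2 * a * ((σ / (2 * a * κ ^ 2)) / (1 + σ / (2 * a * κ ^ 2))) = 2 * a * σ / (σ + 2 * a * κ ^ 2) := by
  have h1 : 0 < 2 * a * κ ^ 2 := by positivity
  have h2 : 0 < σ + 2 * a * κ ^ 2 := by positivity
  field_simp
  ring

end End

/-! ## §5 Toys (kernel): the letters are inhabited and the identities return what they should -/

section Toys

variable {F : Type*} [NormedAddCommGroup F] [InnerProductSpace ℝ F]

/-- `P = id`: the hard value IS `S` (the fibre of `z` is `{z}`). [folklore] -/
theorem hardValue_id (S : F → ℝ) (z : F) : (⨅ y : {y // (LinearMap.id : F →ₗ[ℝ] F) y = z}, S y.1) = S z := by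
  haveI : Nonempty {y // (LinearMap.id : F →ₗ[ℝ] F) y = z} := ⟨⟨z, rfl⟩⟩
  have hfib : ∀ y : {y // (LinearMap.id : F →ₗ[ℝ] F) y = z}, S y.1 = S z := fun y => by
    have hy : y.1 = z := by simpa using y.2
    rw [hy]
  have hb : BddBelow (range fun y : {y // (LinearMap.id : F →ₗ[ℝ] F) y = z} => S y.1) :=
    ⟨S z, by rintro _ ⟨y, rfl⟩; exact (hfib y).symm.le⟩
  exact le_antisymm ((ciInf_le hb ⟨z, rfl⟩).trans_eq (hfib ⟨z, rfl⟩)) (le_ciInf fun y => (hfib y).symm.le)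

/-- Non-vacuity of §4 (`E = F`, `P = id`, `S = 0`): the END's right-hand side is then `2a · e_0(x) = 0` as well, since `prox 0 x = x`
(`x − x = 0 ∈ ∂0(x)`, the tree's `prox_eq_iff`). [folklore] -/
example [FiniteDimensional ℝ F] {a : ℝ} (ha : 0 < a) (x : F) :
    ⨅ y, ((fun _ : F => (0 : ℝ)) y + a * ‖x - (LinearMap.id : F →ₗ[ℝ] F) y‖ ^ 2)
      = 2 * a * proxFun (fun w => (⨅ y : {y // (LinearMap.id : F →ₗ[ℝ] F) y = w}, (fun _ : F => (0 : ℝ)) y.1) / (2 * a)) x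
          (prox (fun w => (⨅ y : {y // (LinearMap.id : F →ₗ[ℝ] F) y = w}, (fun _ : F => (0 : ℝ)) y.1) / (2 * a)) x) :=
  softValue_eq_mul_proxEnv_of_convexOn (convexOn_const 0 convex_univ) ⟨0, by rintro _ ⟨y, rfl⟩; exact le_rfl⟩
    (LinearMap.id : F →ₗ[ℝ] F) (fun z => ⟨z, rfl⟩) ha x

end Toys

end Summit.QuantumFields.BalabanUV.T4Continuum.NE7b.SoftConstraintEnvelope

end
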